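import Literature.Probability.Percolation.TwoClusterConditionalAssociationProofs
import Literature.Probability.LatticeModels.ProdBernoulliIndependence
import Literature.Probability.LatticeModels.ProdBernoulliClusterLocality
import Literature.Probability.Percolation.PercolationEvents
import HarnessLib

/-!
# `NoHeavyLowerTail` (stmt-CriticalPhenomena-4575) — support file: the Gladkov–Zimin three-point covariance
# given NO `c`-avoiding `a–b` path ("THEOREM B" of prover `prim-ineq-prove-2` gen 8, memo
# `run/shared/lean/prim/prim-ineq-prove-2/MEMO-17-THEOREM-B-BHK.md`)

No definitions, no named facts, no sorries.  Setting: Bernoulli bond percolation `μ = prodBernoulli w` on a finite vertex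
type `V` (arbitrary edge weights `w : Sym2 V → [0,1]`), three vertices `a, b, c` ("hub" `c`).  Write `ω ∖ ★` for the
configuration `ω` with all edges at `c` removed (`★ = {e | c ∈ e}`), and `N = {a ↮ b in ω ∖ ★}` for the event that there
is NO open `a–b` path avoiding `c`.

**Theorem (`condNegCorr_hub`).**
`μ(N) · μ(N ∩ {a↔c} ∩ {b↔c}) ≤ μ(N ∩ {a↔c}) · μ(N ∩ {b↔c})`:
given no `c`-avoiding `a–b` path, the events `{a ↔ c}` and `{b ↔ c}` are negatively correlated.  When `c` separates `a`
from `b` (`μ(N) = 1`) this is the independence behind Gladkov–Zimin's Proposition 6.1; in general it is the first step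
("Theorem B") towards their Conjecture 6.3 (= Gladkov 2024, Conj. 10.1): with `x = μ(abc)`, `s = μ(a|b|c)`,
`u_a = μ(bc|a)`, `u_b = μ(ac|b)`, `w = μ(ab|c)` it reads `m·s ≤ u_a·u_b` for `m = μ(abc ∧ a ↮ b off c)`, i.e.
`x s − u_a u_b ≤ μ(a ↔ b off c, c ∈ C)·s`, whence `x s − u_a u_b ≤ μ(ab|c)·(1 − β_c)/β_c` with `β_c = P(c isolated)`
(GZ Conj. 6.3 with `δ = ε·β_c`; the event algebra is left to a sequel file).

Proof: van den Berg–Häggström–Kahn 2006, Thm. 1.4 (tree theorem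
`BHK2006_twoClusterConditionalAssociation_holds.negCorrelation`) applied to the weights `w₀ = w·1{c ∉ e}` (the graph
`G − c`) and the increasing cluster functions `F_x(C) = 1 − ∏_{v ∈ V(C) ∪ {x}, v ≠ c} (1 − w(cv))` = the conditional
probability that `c` has an open edge into the cluster; the two sides are identified with the four `μ`-probabilities by
splitting a configuration into its edges at `c` and the rest (block Fubini for product weights, `BHK2006.blockFubini`)
and the path lemma `reachable_hub_iff` (an open path to `c` = an open path avoiding `c` plus one edge at `c`).
-/

noncomputable section

namespace Summit.CriticalPhenomena.PercolationContinuityZ3.Theorems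

open MeasureTheory Finset Literature.Probability.LatticeModels Literature.Probability.Percolation
open Literature.Probability.Percolation.BHK2006 (weight blockFubini integral_prodBernoulli_eq_sum openGraph_le)
open scoped Classical

namespace GZHub

variable {V : Type*}

/-! ### 1. Open paths to the hub -/

/-- In a configuration whose edges at `c` form `α` and whose other edges form `β`, a vertex `x ≠ c` is joined to
`c` iff some `v ≠ c` joined to `x` inside `β` has its edge `s(c, v)` in `α` (cut an open `x–c` path at its first
arrival at `c`). [folklore] -/
theorem reachable_hub_iff {α β : Set (Sym2 V)} {c : V} (hα : ∀ e ∈ α, c ∈ e) (hβ : ∀ e ∈ β, c ∉ e)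
    {x : V} (hx : x ≠ c) :
    (openGraph (α ∪ β)).Reachable x c ↔ ∃ v, v ≠ c ∧ (openGraph β).Reachable x v ∧ s(c, v) ∈ α := by
  constructor
  · rintro ⟨p⟩
    suffices H : ∀ {x y : V} (_ : (openGraph (α ∪ β)).Walk x y), y = c → x ≠ c →
        ∃ v, v ≠ c ∧ (openGraph β).Reachable x v ∧ s(c, v) ∈ α from H p rfl hx
    intro x y p
    induction p with
    | nil => intro hyc hxc; exact absurd hyc hxc
    | @cons x y z hadj q ih =>
      intro hzc hxc
      rw [openGraph_adj] at hadj
      by_cases hyc : y = c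
      · subst hyc
        refine ⟨x, hxc, SimpleGraph.Reachable.refl x, ?_⟩
        rcases hadj.1 with h | h
        · rw [Sym2.eq_swap]; exact h
        · exact absurd (Sym2.mem_mk_right x y) (hβ _ h)
      · obtain ⟨v, hvc, hyv, hv⟩ := ih hzc hyc
        refine ⟨v, hvc, ?_, hv⟩
        have hxy : s(x, y) ∈ β := by
          rcases hadj.1 with h | h
          · have hc := hα _ h
            rw [Sym2.mem_iff] at hc
            rcases hc with hc | hc
            · exact absurd hc.symm hxc
            · exact absurd hc.symm hyc
          · exact h
        exact ((openGraph_adj β x y).2 ⟨hxy, hadj.2⟩).reachable.trans hyv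
  · rintro ⟨v, hvc, hxv, hv⟩
    have h1 : (openGraph (α ∪ β)).Reachable x v := hxv.mono (openGraph_le Set.subset_union_right)
    have h2 : (openGraph (α ∪ β)).Adj v c :=
      (openGraph_adj _ v c).2 ⟨by rw [Sym2.eq_swap]; exact Set.mem_union_left _ hv, hvc⟩
    exact h1.trans h2.reachable

/-! ### 2. Splitting a configuration at the hub -/

/-- The off-`c` part of the spliced configuration `(ω ∩ ★) ∪ (ω' ∖ ★)` is `ω' ∖ ★`. [folklore] -/
theorem splice_sdiff (ω ω' : Set (Sym2 V)) (c : V) :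
    ((ω ∩ {e | c ∈ e}) ∪ (ω' \ {e | c ∈ e})) \ {e : Sym2 V | c ∈ e} = ω' \ {e | c ∈ e} := by
  ext e
  simp only [Set.mem_sdiff, Set.mem_union, Set.mem_inter_iff, Set.mem_setOf_eq]
  tauto

/-- An edge at `c` belongs to the spliced configuration iff it belongs to `ω`. [folklore] -/
theorem mem_splice_of_mem (ω ω' : Set (Sym2 V)) {c : V} {e : Sym2 V} (he : c ∈ e) :
    e ∈ (ω ∩ {e | c ∈ e}) ∪ (ω' \ {e | c ∈ e}) ↔ e ∈ ω := by
  simp only [Set.mem_union, Set.mem_inter_iff, Set.mem_setOf_eq, Set.mem_sdiff]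
  tauto

/-- `ω = (ω ∩ ★) ∪ (ω ∖ ★)`. [folklore] -/
theorem inter_union_sdiff (ω : Set (Sym2 V)) (c : V) :
    (ω ∩ {e | c ∈ e}) ∪ (ω \ {e | c ∈ e}) = ω := Set.inter_union_sdiff ω _

variable [Fintype V]

/-! ### 3. The product weights: sums, probabilities, and the block split at the hub -/

/-- Total mass one. [folklore] -/
theorem sum_weight (w : Sym2 V → unitInterval) : ∑ ω : Set (Sym2 V), weight (fun e => (w e : ℝ)) ω = 1 := by
  have h1 := integral_prodBernoulli_eq_sum w fun _ => (1 : ℝ)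
  simp only [integral_const, probReal_univ, smul_eq_mul, mul_one] at h1
  exact h1.symm

/-- `μ(E)` as a weighted sum of the indicator. [folklore] -/
theorem real_eq_sum (w : Sym2 V → unitInterval) (E : Set (Set (Sym2 V))) :
    (prodBernoulli w).real E = ∑ ω : Set (Sym2 V), weight (fun e => (w e : ℝ)) ω * E.indicator 1 ω := by
  rw [← integral_indicator_one (MeasurableSet.of_discrete (s := E)), integral_prodBernoulli_eq_sum]

/-- **Block split at the hub.** `E_μ[Φ(ω ∩ ★, ω ∖ ★)] = E_{ω'} E_{ω} [Φ(ω ∩ ★, ω' ∖ ★)]` (`BHK2006.blockFubini` with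
total mass one). [folklore] -/
theorem sum_split (w : Sym2 V → unitInterval) (A : Set (Sym2 V)) (Φ : Set (Sym2 V) → Set (Sym2 V) → ℝ) :
    ∑ ω : Set (Sym2 V), weight (fun e => (w e : ℝ)) ω * Φ (ω ∩ A) (ω \ A) =
      ∑ ω' : Set (Sym2 V), weight (fun e => (w e : ℝ)) ω' *
        ∑ ω : Set (Sym2 V), weight (fun e => (w e : ℝ)) ω * Φ (ω ∩ A) (ω' \ A) := by
  have h := blockFubini (fun e => (w e : ℝ)) A Φ
  rw [sum_weight, one_mul] at h
  rw [h]
  simp_rw [Finset.mul_sum]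
  rw [Finset.sum_comm]
  refine Finset.sum_congr rfl fun ω' _ => Finset.sum_congr rfl fun ω _ => ?_
  ring

/-! ### 4. The hub weights zeroed: `w₀ = w · 1{c ∉ e}` and the marginalisation identity -/

/-- **Marginalisation.** Integrating `h` against the weights with the edges at `c` switched off is integrating
`h(ω ∖ ★)` against the original weights. [folklore] -/
theorem integral_zeroHub (w : Sym2 V → unitInterval) (c : V) (h : Set (Sym2 V) → ℝ) :
    ∫ ω, h ω ∂(prodBernoulli fun e => if c ∈ e then (0 : unitInterval) else w e) =
      ∫ ω, h (ω \ {e | c ∈ e}) ∂(prodBernoulli w) := by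
  set w₀ : Sym2 V → unitInterval := fun e => if c ∈ e then (0 : unitInterval) else w e with hw₀
  set A : Set (Sym2 V) := {e | c ∈ e} with hA
  -- a.s. no edge at `c` is present under `w₀`
  have hae : ∀ᵐ ω ∂(prodBernoulli w₀), ω \ A = ω := by
    have h0 : ∀ e ∈ A, w₀ e = 0 := fun e he => by
      simp only [hw₀, hA, Set.mem_setOf_eq] at he ⊢; rw [if_pos he]
    filter_upwards [prodBernoulli_ae_forall_notMem w₀ (Set.toFinite A).countable h0] with ω hω
    exact sdiff_eq_left.2 (Set.disjoint_left.2 fun e heω heA => hω e heA heω)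
  have step1 : ∫ ω, h ω ∂(prodBernoulli w₀) = ∫ ω, h (ω \ A) ∂(prodBernoulli w₀) :=
    integral_congr_ae (hae.mono fun ω hω => by simp only [hω])
  rw [step1]
  -- the map `ω ↦ ω ∖ ★` has the same law under `w₀` and `w` (they agree off `★`)
  have hoff : Measurable fun ω : Set (Sym2 V) => ω \ A := Measurable.of_discrete
  have hdet : ∀ S : Set (Set (Sym2 V)), DeterminedBy ((fun ω : Set (Sym2 V) => ω \ A) ⁻¹' S) Aᶜ := by
    intro S
    rw [determinedBy_iff]
    intro ω ω' hωω'
    have : ω \ A = ω' \ A := by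
      rw [Set.sdiff_eq, Set.sdiff_eq]; exact hωω'
    simp only [Set.mem_preimage, this]
  have hmap : (prodBernoulli w₀).map (fun ω => ω \ A) = (prodBernoulli w).map (fun ω => ω \ A) := by
    ext S hS
    rw [Measure.map_apply hoff hS, Measure.map_apply hoff hS]
    refine prodBernoulli_apply_eq_of_determinedBy w₀ w (F := Aᶜ) (fun e he => ?_) (hdet S)
      MeasurableSet.of_discrete
    simp only [hA, Set.mem_compl_iff, Set.mem_setOf_eq] at he
    simp only [hw₀, if_neg he]
  have hh : ∀ ν : Measure (Set (Sym2 V)), AEStronglyMeasurable h ν := fun ν =>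
    (Measurable.of_discrete (f := h)).aestronglyMeasurable
  rw [← integral_map hoff.aemeasurable (hh _), hmap, integral_map hoff.aemeasurable (hh _)]

/-! ### 5. The edges at the hub: hitting probabilities -/

/-- `P(some edge c–v, v ∈ T, is open) = 1 − ∏_{v ∈ T} (1 − w(cv))`. [folklore] -/
theorem real_hit (w : Sym2 V → unitInterval) (c : V) (T : Finset V) :
    (prodBernoulli w).real {η : Set (Sym2 V) | ∃ v ∈ T, s(c, v) ∈ η} =
      1 - ∏ v ∈ T, (1 - (w s(c, v) : ℝ)) := by
  have hcompl : ({η : Set (Sym2 V) | ∃ v ∈ T, s(c, v) ∈ η})ᶜ =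
      {η | ∀ i ∈ T.image (fun v => s(c, v)), i ∉ η} := by
    ext η
    simp only [Set.mem_compl_iff, Set.mem_setOf_eq, not_exists, not_and, Finset.mem_image,
      forall_exists_index, and_imp]
    constructor
    · rintro h i v hv rfl; exact h v hv
    · intro h v hv hη; exact h _ v hv rfl hη
  have h1 : (prodBernoulli w).real ({η : Set (Sym2 V) | ∃ v ∈ T, s(c, v) ∈ η})ᶜ =
      ∏ v ∈ T, (1 - (w s(c, v) : ℝ)) := by
    rw [hcompl, prodBernoulli_real_forall_notMem, Finset.prod_image]
    intro v _ v' _ h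
    exact Sym2.congr_right.1 h
  have h2 := probReal_compl_eq_one_sub (μ := prodBernoulli w)
    (MeasurableSet.of_discrete (s := {η : Set (Sym2 V) | ∃ v ∈ T, s(c, v) ∈ η}))
  linarith

omit [Fintype V] in
/-- The hitting event is determined by the edges `{cv : v ∈ T}`. [folklore] -/
theorem determinedBy_hit (c : V) (T : Finset V) :
    DeterminedBy {η : Set (Sym2 V) | ∃ v ∈ T, s(c, v) ∈ η} (↑(T.image fun v => s(c, v)) : Set (Sym2 V)) := by
  rw [determinedBy_iff]
  intro ω ω' h
  simp only [Set.mem_setOf_eq]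
  constructor
  · rintro ⟨v, hv, hω⟩
    have : s(c, v) ∈ ω ∩ ↑(T.image fun v => s(c, v)) :=
      ⟨hω, Finset.mem_coe.2 (Finset.mem_image.2 ⟨v, hv, rfl⟩)⟩
    rw [h] at this
    exact ⟨v, hv, this.1⟩
  · rintro ⟨v, hv, hω⟩
    have : s(c, v) ∈ ω' ∩ ↑(T.image fun v => s(c, v)) :=
      ⟨hω, Finset.mem_coe.2 (Finset.mem_image.2 ⟨v, hv, rfl⟩)⟩
    rw [← h] at this
    exact ⟨v, hv, this.1⟩

/-- Hitting two DISJOINT vertex sets through edges at `c` are independent events. [folklore] -/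
theorem real_hit_inter (w : Sym2 V → unitInterval) (c : V) {Ta Tb : Finset V} (hd : Disjoint Ta Tb) :
    (prodBernoulli w).real ({η : Set (Sym2 V) | ∃ v ∈ Ta, s(c, v) ∈ η} ∩ {η | ∃ v ∈ Tb, s(c, v) ∈ η}) =
      (prodBernoulli w).real {η : Set (Sym2 V) | ∃ v ∈ Ta, s(c, v) ∈ η} *
        (prodBernoulli w).real {η : Set (Sym2 V) | ∃ v ∈ Tb, s(c, v) ∈ η} := by
  refine prodBernoulli_real_inter_of_determinedBy_disjoint w ?_ (determinedBy_hit c Ta)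
    (determinedBy_hit c Tb) MeasurableSet.of_discrete MeasurableSet.of_discrete
  rw [Finset.disjoint_left]
  intro e hea heb
  obtain ⟨v, hv, rfl⟩ := Finset.mem_image.1 hea
  obtain ⟨v', hv', hvv'⟩ := Finset.mem_image.1 heb
  have : v' = v := Sym2.congr_right.1 hvv'
  subst this
  exact Finset.disjoint_left.1 hd hv hv'

/-! ### 6. The key identification: BHK's integrals under `w₀` are `μ`-probabilities -/

/-- **Key identity.**  For the weights `w₀` (edges at `c` switched off), the cluster function
`F_x(C_x) = P(c has an open edge into the cluster of x)` and the event `D₀ = {a ↮ b}`: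
`∫_{D₀} F_a^[ia] F_b^[ib] dμ₀ = μ(N ∩ {a↔c}^[ia] ∩ {b↔c}^[ib])`, `N = {a ↮ b off c}` (the Boolean exponents switch
the factors on or off). [folklore] -/
theorem key (w : Sym2 V → unitInterval) {a b c : V} (hac : a ≠ c) (hbc : b ≠ c)
    (F : V → Set (Sym2 V) → ℝ)
    (hF : ∀ (x : V) (β : Set (Sym2 V)), F x (openEdgeCluster β x) =
      1 - ∏ v ∈ univ.filter (fun v => v ≠ c ∧ (openGraph β).Reachable x v), (1 - (w s(c, v) : ℝ)))
    (ia ib : Bool) :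
    ∫ ω in {ω : Set (Sym2 V) | ¬ (openGraph ω).Reachable a b}, (fun ω : Set (Sym2 V) => (if ia then F a (openEdgeCluster ω a) else 1) * (if ib then F b (openEdgeCluster ω b) else 1)) ω ∂(prodBernoulli fun e => if c ∈ e then (0 : unitInterval) else w e) =
      (prodBernoulli w).real ({ω : Set (Sym2 V) | ¬ (openGraph (ω \ {e : Sym2 V | c ∈ e})).Reachable a b} ∩ {ω | ia = true → ω ∈ openConn a c} ∩ {ω | ib = true → ω ∈ openConn b c}) := by
  -- both sides as sums over configurations, the right-hand side split at the hub
  rw [← integral_indicator (MeasurableSet.of_discrete (s := {ω : Set (Sym2 V) | ¬ (openGraph ω).Reachable a b})), integral_zeroHub,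
    integral_prodBernoulli_eq_sum, real_eq_sum]
  have hsplit := sum_split w {e : Sym2 V | c ∈ e}
    (fun α β => Set.indicator ({ω : Set (Sym2 V) | ¬ (openGraph (ω \ {e : Sym2 V | c ∈ e})).Reachable a b} ∩ {ω | ia = true → ω ∈ openConn a c} ∩ {ω | ib = true → ω ∈ openConn b c}) (1 : Set (Sym2 V) → ℝ) (α ∪ β))
  simp only [inter_union_sdiff] at hsplit
  rw [hsplit]
  refine Finset.sum_congr rfl fun ω' _ => ?_
  congr 1
  have hβc : ∀ e ∈ (ω' \ {e : Sym2 V | c ∈ e}), c ∉ e := fun e he => he.2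
  -- membership of a spliced configuration in `{x ↔ c}`
  have hconn : ∀ (x : V), x ≠ c → ∀ ω : Set (Sym2 V),
      ((ω ∩ {e : Sym2 V | c ∈ e}) ∪ (ω' \ {e : Sym2 V | c ∈ e}) ∈ openConn x c ↔
        ∃ v ∈ univ.filter (fun v => v ≠ c ∧ (openGraph (ω' \ {e : Sym2 V | c ∈ e})).Reachable x v), s(c, v) ∈ ω) := by
    intro x hx ω
    change (openGraph ((ω ∩ {e : Sym2 V | c ∈ e}) ∪ (ω' \ {e : Sym2 V | c ∈ e}))).Reachable x c ↔ _
    rw [reachable_hub_iff (fun e he => he.2) hβc hx]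
    simp only [Finset.mem_filter, Finset.mem_univ, true_and, Set.mem_inter_iff, Set.mem_setOf_eq]
    constructor
    · rintro ⟨v, hvc, hxv, hv, -⟩; exact ⟨v, ⟨hvc, hxv⟩, hv⟩
    · rintro ⟨v, ⟨hvc, hxv⟩, hv⟩; exact ⟨v, hvc, hxv, hv, Sym2.mem_mk_left c v⟩
  by_cases hR : (openGraph (ω' \ {e : Sym2 V | c ∈ e})).Reachable a b
  · -- an `a–b` path avoiding `c`: both sides vanish
    have hl : Set.indicator {ω : Set (Sym2 V) | ¬ (openGraph ω).Reachable a b} (fun ω : Set (Sym2 V) => (if ia then F a (openEdgeCluster ω a) else 1) * (if ib then F b (openEdgeCluster ω b) else 1)) (ω' \ {e : Sym2 V | c ∈ e}) = 0 :=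
      Set.indicator_of_notMem (show (ω' \ {e : Sym2 V | c ∈ e}) ∉ {ω : Set (Sym2 V) | ¬ (openGraph ω).Reachable a b} from fun h => h hR) _
    rw [hl]
    symm
    refine Finset.sum_eq_zero fun ω _ => ?_
    have : (ω ∩ {e : Sym2 V | c ∈ e}) ∪ (ω' \ {e : Sym2 V | c ∈ e}) ∉ ({ω : Set (Sym2 V) | ¬ (openGraph (ω \ {e : Sym2 V | c ∈ e})).Reachable a b} ∩ {ω | ia = true → ω ∈ openConn a c} ∩ {ω | ib = true → ω ∈ openConn b c}) := by
      rintro ⟨⟨h1, -⟩, -⟩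
      have h2 : ¬ (openGraph (((ω ∩ {e : Sym2 V | c ∈ e}) ∪ (ω' \ {e : Sym2 V | c ∈ e})) \ {e : Sym2 V | c ∈ e})).Reachable a b := h1
      rw [splice_sdiff] at h2
      exact h2 hR
    rw [Set.indicator_of_notMem this, mul_zero]
  · -- no such path: the integrand is the product of the two hitting indicators
    have hl : Set.indicator {ω : Set (Sym2 V) | ¬ (openGraph ω).Reachable a b} (fun ω : Set (Sym2 V) => (if ia then F a (openEdgeCluster ω a) else 1) * (if ib then F b (openEdgeCluster ω b) else 1)) (ω' \ {e : Sym2 V | c ∈ e}) = (fun ω : Set (Sym2 V) => (if ia then F a (openEdgeCluster ω a) else 1) * (if ib then F b (openEdgeCluster ω b) else 1)) (ω' \ {e : Sym2 V | c ∈ e}) :=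
      Set.indicator_of_mem (show (ω' \ {e : Sym2 V | c ∈ e}) ∈ {ω : Set (Sym2 V) | ¬ (openGraph ω).Reachable a b} from hR) _
    rw [hl]
    have hN : ∀ ω : Set (Sym2 V), (ω ∩ {e : Sym2 V | c ∈ e}) ∪ (ω' \ {e : Sym2 V | c ∈ e}) ∈ {ω : Set (Sym2 V) | ¬ (openGraph (ω \ {e : Sym2 V | c ∈ e})).Reachable a b} := by
      intro ω
      show ¬ (openGraph (((ω ∩ {e : Sym2 V | c ∈ e}) ∪ (ω' \ {e : Sym2 V | c ∈ e})) \ {e : Sym2 V | c ∈ e})).Reachable a b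
      rw [splice_sdiff]; exact hR
    have hmemE : ∀ ω : Set (Sym2 V), (ω ∩ {e : Sym2 V | c ∈ e}) ∪ (ω' \ {e : Sym2 V | c ∈ e}) ∈ ({ω : Set (Sym2 V) | ¬ (openGraph (ω \ {e : Sym2 V | c ∈ e})).Reachable a b} ∩ {ω | ia = true → ω ∈ openConn a c} ∩ {ω | ib = true → ω ∈ openConn b c}) ↔
        ((ia = true → ω ∈ {η : Set (Sym2 V) | ∃ v ∈ (univ.filter (fun v => v ≠ c ∧ (openGraph (ω' \ {e : Sym2 V | c ∈ e})).Reachable a v)), s(c, v) ∈ η}) ∧ (ib = true → ω ∈ {η : Set (Sym2 V) | ∃ v ∈ (univ.filter (fun v => v ≠ c ∧ (openGraph (ω' \ {e : Sym2 V | c ∈ e})).Reachable b v)), s(c, v) ∈ η})) := by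
      intro ω
      simp only [Set.mem_inter_iff]
      constructor
      · rintro ⟨⟨-, h1⟩, h2⟩
        exact ⟨fun hia => (hconn a hac ω).1 (h1 hia), fun hib => (hconn b hbc ω).1 (h2 hib)⟩
      · rintro ⟨h1, h2⟩
        exact ⟨⟨hN ω, fun hia => (hconn a hac ω).2 (h1 hia)⟩, fun hib => (hconn b hbc ω).2 (h2 hib)⟩
    have hsummand : ∀ ω : Set (Sym2 V), Set.indicator ({ω : Set (Sym2 V) | ¬ (openGraph (ω \ {e : Sym2 V | c ∈ e})).Reachable a b} ∩ {ω | ia = true → ω ∈ openConn a c} ∩ {ω | ib = true → ω ∈ openConn b c}) (1 : Set (Sym2 V) → ℝ) ((ω ∩ {e : Sym2 V | c ∈ e}) ∪ (ω' \ {e : Sym2 V | c ∈ e})) =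
        (if ia then Set.indicator {η : Set (Sym2 V) | ∃ v ∈ (univ.filter (fun v => v ≠ c ∧ (openGraph (ω' \ {e : Sym2 V | c ∈ e})).Reachable a v)), s(c, v) ∈ η} 1 ω else 1) * (if ib then Set.indicator {η : Set (Sym2 V) | ∃ v ∈ (univ.filter (fun v => v ≠ c ∧ (openGraph (ω' \ {e : Sym2 V | c ∈ e})).Reachable b v)), s(c, v) ∈ η} 1 ω else 1) := by
      intro ω
      have hm := hmemE ω
      simp only [Set.indicator_apply, Pi.one_apply, hm]
      by_cases ha : ∃ v, (¬ v = c ∧ (openGraph (ω' \ {e : Sym2 V | c ∈ e})).Reachable a v) ∧ s(c, v) ∈ ω <;>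
      by_cases hb : ∃ v, (¬ v = c ∧ (openGraph (ω' \ {e : Sym2 V | c ∈ e})).Reachable b v) ∧ s(c, v) ∈ ω <;>
      cases ia <;> cases ib <;> simp [ha, hb]
    simp_rw [hsummand]
    -- evaluate the four sums
    have hdisj : Disjoint (univ.filter (fun v => v ≠ c ∧ (openGraph (ω' \ {e : Sym2 V | c ∈ e})).Reachable a v)) (univ.filter (fun v => v ≠ c ∧ (openGraph (ω' \ {e : Sym2 V | c ∈ e})).Reachable b v)) := by
      rw [Finset.disjoint_left]
      intro v hva hvb
      simp only [Finset.mem_filter, Finset.mem_univ, true_and] at hva hvb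
      exact hR (hva.2.trans hvb.2.symm)
    have e2 : ∑ ω : Set (Sym2 V), weight (fun e => (w e : ℝ)) ω * (Set.indicator {η : Set (Sym2 V) | ∃ v ∈ (univ.filter (fun v => v ≠ c ∧ (openGraph (ω' \ {e : Sym2 V | c ∈ e})).Reachable a v)), s(c, v) ∈ η} 1 ω * Set.indicator {η : Set (Sym2 V) | ∃ v ∈ (univ.filter (fun v => v ≠ c ∧ (openGraph (ω' \ {e : Sym2 V | c ∈ e})).Reachable b v)), s(c, v) ∈ η} 1 ω) =
        (1 - ∏ v ∈ (univ.filter (fun v => v ≠ c ∧ (openGraph (ω' \ {e : Sym2 V | c ∈ e})).Reachable a v)), (1 - (w s(c, v) : ℝ))) * (1 - ∏ v ∈ (univ.filter (fun v => v ≠ c ∧ (openGraph (ω' \ {e : Sym2 V | c ∈ e})).Reachable b v)), (1 - (w s(c, v) : ℝ))) := by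
      rw [← real_hit w c (univ.filter (fun v => v ≠ c ∧ (openGraph (ω' \ {e : Sym2 V | c ∈ e})).Reachable a v)), ← real_hit w c (univ.filter (fun v => v ≠ c ∧ (openGraph (ω' \ {e : Sym2 V | c ∈ e})).Reachable b v)), ← real_hit_inter w c hdisj, real_eq_sum]
      refine Finset.sum_congr rfl fun ω _ => ?_
      congr 1
      exact (congrFun (Set.inter_indicator_one (s := {η : Set (Sym2 V) | ∃ v ∈ (univ.filter (fun v => v ≠ c ∧ (openGraph (ω' \ {e : Sym2 V | c ∈ e})).Reachable a v)), s(c, v) ∈ η})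
        (t := {η : Set (Sym2 V) | ∃ v ∈ (univ.filter (fun v => v ≠ c ∧ (openGraph (ω' \ {e : Sym2 V | c ∈ e})).Reachable b v)), s(c, v) ∈ η}) (M₀ := ℝ)) ω).symm
    have e1 : ∀ T' : Finset V, ∑ ω : Set (Sym2 V), weight (fun e => (w e : ℝ)) ω * Set.indicator {η : Set (Sym2 V) | ∃ v ∈ T', s(c, v) ∈ η} 1 ω =
        1 - ∏ v ∈ T', (1 - (w s(c, v) : ℝ)) :=
      fun T' => by rw [← real_hit w c T', real_eq_sum]
    have e0 := sum_weight w
    have hFa := hF a (ω' \ {e : Sym2 V | c ∈ e})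
    have hFb := hF b (ω' \ {e : Sym2 V | c ∈ e})
    cases ia <;> cases ib <;>
      simp only [Bool.false_eq_true, ↓reduceIte, mul_one, one_mul, e0, e1, e2, hFa, hFb]

/-! ### 7. THEOREM B: conditional negative correlation given no `c`-avoiding `a–b` path -/

/-- The cluster function `C ↦ 1 − ∏_{v ≠ c, v = x ∨ v ∈ V(C)} (1 − w(cv))` (probability that `c` has an open edge
into the vertex set of `C` together with `x`) is increasing. [folklore] -/
theorem attach_mono (w : Sym2 V → unitInterval) (c x : V) :
    Monotone fun C : Set (Sym2 V) =>
      1 - ∏ v ∈ univ.filter (fun v => v ≠ c ∧ (v = x ∨ ∃ e ∈ C, v ∈ e)), (1 - (w s(c, v) : ℝ)) := by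
  intro C C' hCC'
  have hsub : univ.filter (fun v => v ≠ c ∧ (v = x ∨ ∃ e ∈ C, v ∈ e)) ⊆
      univ.filter (fun v => v ≠ c ∧ (v = x ∨ ∃ e ∈ C', v ∈ e)) := by
    intro v hv
    simp only [Finset.mem_filter, Finset.mem_univ, true_and] at hv ⊢
    exact ⟨hv.1, hv.2.imp id fun ⟨e, he, hve⟩ => ⟨e, hCC' he, hve⟩⟩
  have h0 : ∀ v : V, 0 ≤ 1 - (w s(c, v) : ℝ) := fun v => sub_nonneg.2 (w s(c, v)).2.2
  have h1 : ∀ v : V, 1 - (w s(c, v) : ℝ) ≤ 1 := fun v => sub_le_self _ (w s(c, v)).2.1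
  have hprod := Finset.prod_sdiff hsub (f := fun v => 1 - (w s(c, v) : ℝ))
  have hle : ∏ v ∈ univ.filter (fun v => v ≠ c ∧ (v = x ∨ ∃ e ∈ C', v ∈ e)), (1 - (w s(c, v) : ℝ)) ≤
      ∏ v ∈ univ.filter (fun v => v ≠ c ∧ (v = x ∨ ∃ e ∈ C, v ∈ e)), (1 - (w s(c, v) : ℝ)) := by
    rw [← hprod]
    exact mul_le_of_le_one_left (Finset.prod_nonneg fun v _ => h0 v)
      (Finset.prod_le_one (fun v _ => h0 v) fun v _ => h1 v)
  simp only
  linarith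

/-- **THEOREM B (prim-ineq-prove-2, MEMO-17): given NO open `a–b` path avoiding `c`, the events `{a ↔ c}` and
`{b ↔ c}` are negatively correlated** — `μ(N)·μ(N ∩ {a↔c} ∩ {b↔c}) ≤ μ(N ∩ {a↔c})·μ(N ∩ {b↔c})` with
`N = {ω | a ↮ b in ω ∖ {edges at c}}`, on every finite weighted graph (van den Berg–Häggström–Kahn 2006 Thm. 1.4
for the graph `G − c` and the cluster-attachment probabilities). [cite: VandenbergHaggstromKahn2005, Thm. 1.4 (p. 7)] -/
theorem condNegCorr_hub (w : Sym2 V → unitInterval) {a b c : V} (hab : a ≠ b) (hac : a ≠ c) (hbc : b ≠ c) :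
    (prodBernoulli w).real {ω : Set (Sym2 V) | ¬ (openGraph (ω \ {e | c ∈ e})).Reachable a b} *
      (prodBernoulli w).real ({ω : Set (Sym2 V) | ¬ (openGraph (ω \ {e | c ∈ e})).Reachable a b} ∩
        (openConn a c ∩ openConn b c)) ≤
    (prodBernoulli w).real ({ω : Set (Sym2 V) | ¬ (openGraph (ω \ {e | c ∈ e})).Reachable a b} ∩ openConn a c) *
      (prodBernoulli w).real ({ω : Set (Sym2 V) | ¬ (openGraph (ω \ {e | c ∈ e})).Reachable a b} ∩
        openConn b c) := by
  set F : V → Set (Sym2 V) → ℝ := fun x C =>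
    1 - ∏ v ∈ univ.filter (fun v => v ≠ c ∧ (v = x ∨ ∃ e ∈ C, v ∈ e)), (1 - (w s(c, v) : ℝ)) with hFdef
  have hF : ∀ (x : V) (β : Set (Sym2 V)), F x (openEdgeCluster β x) =
      1 - ∏ v ∈ univ.filter (fun v => v ≠ c ∧ (openGraph β).Reachable x v), (1 - (w s(c, v) : ℝ)) := by
    intro x β
    simp only [hFdef]
    congr 2
    refine Finset.filter_congr fun v _ => ?_
    rw [reachable_iff_exists_mem_openEdgeCluster β x v]
  have hBHK := BHK2006_twoClusterConditionalAssociation_holds.negCorrelation V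
    (fun e => if c ∈ e then (0 : unitInterval) else w e) a b (F a) (F b)
    (attach_mono w c a) (attach_mono w c b) hab
  have k11 := key w hac hbc F hF true true
  have k10 := key w hac hbc F hF true false
  have k01 := key w hac hbc F hF false true
  have k00 := key w hac hbc F hF false false
  simp only [↓reduceIte, Bool.false_eq_true, mul_one, one_mul, true_implies, false_implies, Set.setOf_true,
    Set.inter_univ] at k11 k10 k01 k00
  rw [setIntegral_const, smul_eq_mul, mul_one] at k00
  rw [k00, k11, k10, k01] at hBHK
  simpa only [Set.setOf_mem_eq, Set.inter_assoc] using hBHK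

end GZHub

end Summit.CriticalPhenomena.PercolationContinuityZ3.Theorems

end
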